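import Literature.MathematicalPhysics.QuantumFieldTheory.Balaban1983to89.B1Eq211ZeroFieldTorus
import Literature.MathematicalPhysics.QuantumFieldTheory.Balaban1983to89.B1Ineq367SmallField

/-!
# `Balaban1983to89.B1Ineq225ZeroFieldTorus` — T. Bałaban, *(Higgs)₂,₃ quantum fields in a finite volume. I. A lower bound*,
# Commun. Math. Phys. **85** (1982) 603–626 [Balaban1982Higgs1]: the propagator (2.20) `G^ε_K = (−Δ^ε + μ₀² + a_K(L^Kε)^{−2}P_K)^{−1}`
# OF THE (Higgs)₂,₃ MODEL AT ZERO FIELD IS `(L^Kε)²·G_K` of Bałaban's scalar torus tower (`B1RG242Torus`, the rescaling (2.22)),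
# and the sup-norm half of Prop. 2.1 (2.25), `‖G^ε_Kg‖_∞ ≦ c₀(L^Kε)²‖g‖_∞`, PROVED for it — uniformly in the volume and in
# `L^Kε ≦ ε₀` — from B4's Theorem (1.10) on the torus (p38's `B4Thm110ZeroTorus`); hence the vector-field half of the
# (3.67) replacement (`B1Ineq367SmallField`, input `hGv`) holds WITHOUT that input on the torus sub-family `M·L′_μ = L^m`

statement-level skeleton of published theorems with citation tags; proofs where landed; nothing here is a claim about the Yang–Mills mass gap

PDF held: `paper:balaban1982-cmp85-higgs23-i` (journal page = PDF page + 602); p. 610 [PDF 8] ((2.20), (2.22), Prop. 2.1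
(2.24)–(2.25)), p. 617 [PDF 15] ((3.27)–(3.29)), p. 625 [PDF 23] ((3.67)); ×2 renders
`run/shared/lean/pub/pub-balaban/b2b-balaban-ref1/pages/1982-cmp85-higgs23-I/1982-cmp85-higgs23-I-p008|p015|p023-x2.png`;
B4 = [Balaban1983RegularityDecay] p. 573 [PDF 3] (Theorem (1.10)), held `paper:balaban1983-cmp89-regularity-decay`.

CITATION HEADER (lean-in-tree rule).  Cell `lit-balaban` (HOME `run/shared/lean/pub/lit-balaban/`), Phase-2 proof seat **p14**
gen 8 (unit `lit-balaban-p14`), file 2 of the pair opened by `B1Eq211ZeroFieldTorus`; SKELETON rows **B1.Eq2.20**, **B1.Prop2.1**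
((2.25), sup-norm clause, `A = 0`, torus: MODEL INSTANCE for the (Higgs)₂,₃ carrier), **B1.Eq3.66–3.67** (r12) / **B1.Thm@606** (E3).
USED BY NAME, never restated: p38's `B4Thm110ZeroTorus.{value_row_bound, kerBounds_torus, cTerm}`, pv07/p38's
`B1RG242Torus.{tower, G_arg}`, `B1RG242.StepData.{Gk_mul, mul_Gk}`, `B5Leaf237C0Torus.{blockOp_inv_decay, G0unit_eq, gamma0,
dK0}`, `B5Display136Torus.G0unit`, `B5Ineq137Torus.T`; the typer's `HiggsCovariance.{covOpK, propagatorK}`; this seat's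
`B1Eq211ZeroFieldTorus.{Shape, eSite, cmp, cmp_covOpK, eq_of_cmp_eq}` (file 1) and `B1Ineq367SmallField.chiKA_eq_one_of_small`.

WHAT IS PRINTED (verbatim).  p. 610 [PDF 8]: (2.20) *"G^ε_k(Ω,A) = (−Δ^{ε,N}_{A,Ω} + m² + a_k(L^kε)^{−2}P_k(A))^{−1}"*; (2.22)
*"G_k(Ω,A) = (−Δ^{η,N}_{A,Ω} + m²(L^kε)² + a_kP_k(A))^{−1}, η = L^{−k}"*; Prop. 2.1: *"there exist constants δ₀ > 0, c₀, such
that … |(G^ε_k(Ω,A)f)(x)| ≦ c₀(L^kε)² exp(−δ₀(L^kε)^{−1} dist(x, supp f)) sup_x|f(x)| … (2.25) … The constants … depend on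
d, a, M, α only"* ⟦the display (2.24)–(2.25) is partly illegible on the held scan; the (L^kε)² factor and the sup norm are
legible, and are what is used on p. 621/625⟧; B4 p. 573 [PDF 3], Theorem: *"|(G_k(Ω,A)f)(x)| ≦ c₀exp(−δ₀dist(x, supp f))‖f‖_∞ (1.10)"*.

WHAT THIS FILE PROVES (kernel-checked, zero `sorry`; ONE new `def`, the transport `liftOp` of a torus matrix to an operator on
`ℝ^N`-valued fields; no `def … : Prop`, no new named fact; axioms standard).
* §1 `liftOp`, `liftOp_apply`, `cmp_liftOp`.
* §2 **(2.20) = (L^Kε)²·(2.22) ON THE TORUS TOWER**: `covOpK_mul_lift`, `lift_mul_covOpK` (two-sided inverse), `isUnit_covOpK_zero`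
  (the operator of (2.20) at zero field IS invertible on the model's carrier — the typer's `propagatorK` is `Ring.inverse`, here
  shown to be a genuine inverse, `1 ≦ K`, `μ₀² ≧ 0`, `a > 0`), **`propagatorK_zero_eq`**, **`propagatorK_zero_apply`**:
  `(G^ε_Kg)(x)_i = ℓ²·(G_K cmp_i g)(e x)`, `G_K = (B1RG242Torus.tower P_S a (μ₀²ℓ²)).G K`, `ℓ = L^Kε`.
* §3 `G0unit_decay_cap` (the `C^{(0)}` kernel bound of (2.37) with a rate uniform under a mass cap), **`torus_sup_bound`**: B4 (1.10)
  value clause at the top level with `D = 0`, constant uniform in the volume and in the mass `≦ m₊²` (from `value_row_bound`).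
* §4 **`propagatorK_sup_bound`** — **(2.25), SUP-NORM CLAUSE, FOR THE MODEL'S VECTOR PROPAGATOR AT `A = 0`**: for `d ≧ 1`, odd `L > 1`,
  `a > 0`, `μ₀² ≧ 0`, `ε₀` there is `c₀ > 0` with `‖(G^ε_Kg)(x)‖ ≦ c₀(L^Kε)²·M` for every torus of the sub-family (`Shape`), every
  `1 ≦ K` with `L^Kε ≦ ε₀`, every `g : T_ε → ℝ^d` with `‖g‖ ≦ M` — the input `hGv` of `B1Ineq367SmallField.chiW_eq_one_of_smallSet`;
  §5 **`chiKA_eq_one_of_small_torus`**: (3.27)'s `χ_K(A) = 1` on `{|A(x)| ≦ c₁^{−1}(L^Kε)^{−(d−2)/2}p}` with NO displayed input on that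
  sub-family (the vector-field half of (3.67)/(E3)).
HONEST SCOPE: `A = 0`, trivial coupling (the vector-field case, p. 608), whole torus, tori with `M·L′_μ = L^m` and `L` odd (file 1),
top level `K ≧ 1`; the decay factor of (2.25) and the Hölder clause are not transported here (B4 (1.9)/(1.10) carry them on
`Setup`'s carrier: `B4Thm19ZeroTorus`, `B4Thm110ZeroTorus`); the scalar half of (E3) (`G^ε_K(T_ε, A^{(K),ε})`, `A ≠ 0`) remains the
displayed input `hGs`.  Unit `lit-balaban-p14` gen 8 (literature-prover-lit-balaban-p14-g8-0).
-/

open scoped BigOperators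
open Matrix

namespace Literature.MathematicalPhysics.QuantumFieldTheory.Balaban1983to89.B1Ineq225ZeroFieldTorus

open Literature.MathematicalPhysics.QuantumFieldTheory.Balaban1983to89.HiggsCovariance (covOpK propagatorK)
open Literature.MathematicalPhysics.QuantumFieldTheory.Balaban1983to89.B3MultiscaleFields (zeroCharge toSite)
open Literature.MathematicalPhysics.QuantumFieldTheory.Balaban1983to89.B1Eq31Concrete (chiKA thrF)
open Literature.MathematicalPhysics.QuantumFieldTheory.Balaban1983to89.B1RG242Torus (tower Qk Qks H α G_arg one_lt_cast_L lvl
  sitesPerDir_zero_eq)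
open Literature.MathematicalPhysics.QuantumFieldTheory.Balaban1983to89.B5Display136Torus (G0unit)
open Literature.MathematicalPhysics.QuantumFieldTheory.Balaban1983to89.B5Ineq137Torus (T T_nonneg)
open Literature.MathematicalPhysics.QuantumFieldTheory.Balaban1983to89.B5Leaf237C0Torus (blockOp_inv_decay G0unit_eq gamma0 dK0
  gamma0_pos gamma0_le dK0_pos eps_le_one)
open Literature.MathematicalPhysics.QuantumFieldTheory.Balaban1983to89.B4Thm110ZeroTorus (KerBounds cTerm cTerm_nonneg
  value_row_bound kerBounds_torus)
open Literature.MathematicalPhysics.QuantumFieldTheory.Balaban1983to89.B1Eq211ZeroFieldTorus (Shape eSite cmp cmp_apply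
  cmp_apply_eSite cmp_covOpK eq_of_cmp_eq)
open Literature.MathematicalPhysics.QuantumFieldTheory.Balaban1983to89.B1Ineq367SmallField (chiKA_eq_one_of_small)

variable {P : HiggsLattice.Params}

/-! ## §1 Transport of a torus matrix to an operator on `ℝ^N`-valued fields, component by component -/

section Lift

variable (S : Shape P) {N : ℕ}

/-- **The transport of a matrix on `Setup`'s torus to an operator on the model's `ℝ^N`-valued fields**, acting on each component:
`(lift G φ)(x)_i = (G cmp_iφ)(e x)` (p. 608: the vector-field case is `N` copies of the scalar one, *"taking N = d and an external
vector field A = 0"*). [cite: Balaban1982Higgs1, (2.20) p.610] -/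
noncomputable def liftOp (G : Matrix (Site S.toSetup 0) (Site S.toSetup 0) ℝ) :
    Module.End ℝ (HiggsLattice.ScalarField P 0 N) where
  toFun φ := fun x => WithLp.toLp 2 fun i => (G *ᵥ cmp S i φ) (eSite S (Nat.zero_le _) x)
  map_add' φ ψ := by
    funext x
    refine PiLp.ext fun i => ?_
    simp only [map_add, Matrix.mulVec_add, Pi.add_apply, PiLp.add_apply]
  map_smul' c φ := by
    funext x
    refine PiLp.ext fun i => ?_
    simp only [map_smul, Matrix.mulVec_smul, Pi.smul_apply, PiLp.smul_apply, smul_eq_mul, RingHom.id_apply]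

/-- Unfolding of `liftOp`. [cite: Balaban1982Higgs1, (2.20) p.610] -/
theorem liftOp_apply (G : Matrix (Site S.toSetup 0) (Site S.toSetup 0) ℝ) (φ : HiggsLattice.ScalarField P 0 N)
    (x : HiggsLattice.Site P 0) (i : Fin N) :
    liftOp S G φ x i = (G *ᵥ cmp S i φ) (eSite S (Nat.zero_le _) x) := rfl

/-- The components of the transported operator are the matrix applied to the components. [cite: Balaban1982Higgs1, (2.20) p.610] -/
theorem cmp_liftOp (G : Matrix (Site S.toSetup 0) (Site S.toSetup 0) ℝ) (φ : HiggsLattice.ScalarField P 0 N) (i : Fin N) :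
    cmp S i (liftOp S G φ) = G *ᵥ cmp S i φ := by
  funext z
  rw [cmp_apply, liftOp_apply, Equiv.apply_symm_apply]

end Lift

/-! ## §2 (2.20) at zero field is `(L^Kε)²·G_K` of the torus tower: a genuine two-sided inverse -/

section Propagator

variable (S : Shape P)

/-- `G_K` of the torus tower is the matrix inverse of `H + α_KQ^*_KQ_K` (unfolding of `B1RG242.Tower.G`).
[cite: Balaban1982Higgs1, (2.20) p.610] -/
theorem towerG_eq (Q : Params) (a msq : ℝ) (k : ℕ) :
    (tower Q a msq).G k = (H Q msq + α Q a k • (Qks Q k * Qk Q k))⁻¹ := rfl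

/-- `(H + α_KQ^*_KQ_K)·G_K = 1` on the torus (`G_arg`: the operator is invertible for `a > 0`, `m² ≧ 0`, `K ≧ 1`).
[cite: Balaban1982Higgs1, (2.20) p.610] -/
theorem opS_mul_G (Q : Params) {a msq : ℝ} (ha : 0 < a) (hm : 0 ≤ msq) {k : ℕ} (hk : 1 ≤ k) :
    (H Q msq + α Q a k • (Qks Q k * Qk Q k)) * (tower Q a msq).G k = 1 :=
  B1RG242.StepData.Gk_mul ((tower Q a msq).step k) (G_arg Q ha hm k hk)

/-- `G_K·(H + α_KQ^*_KQ_K) = 1` on the torus. [cite: Balaban1982Higgs1, (2.20) p.610] -/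
theorem G_mul_opS (Q : Params) {a msq : ℝ} (ha : 0 < a) (hm : 0 ≤ msq) {k : ℕ} (hk : 1 ≤ k) :
    (tower Q a msq).G k * (H Q msq + α Q a k • (Qks Q k * Qk Q k)) = 1 :=
  B1RG242.StepData.mul_Gk ((tower Q a msq).step k) (G_arg Q ha hm k hk)

variable {mu0sq a : ℝ}

/-- **Right inverse**: `(−Δ^ε + μ₀² + a_K(L^Kε)^{−2}P_K)·(ℓ²·lift G_K) = 1`, `G_K` the top propagator of the torus tower at mass `μ₀²ℓ²`,
`ℓ = L^Kε`. [cite: Balaban1982Higgs1, (2.20) p.610; (2.22) p.610] -/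
theorem covOpK_mul_lift (hK1 : 1 ≤ P.K) (ha : 0 < a) (hmu : 0 ≤ mu0sq) :
    covOpK (zeroCharge P.d) Finset.univ (0 : HiggsLattice.VecField P 0) mu0sq a P.K
        * ((P.mesh P.K ^ 2) • liftOp S ((tower S.toSetup a (mu0sq * P.mesh P.K ^ 2)).G P.K)) = 1 := by
  have hℓ2 : P.mesh P.K ^ 2 ≠ 0 := pow_ne_zero 2 (P.mesh_pos P.K).ne'
  have hm : 0 ≤ mu0sq * P.mesh P.K ^ 2 := mul_nonneg hmu (sq_nonneg _)
  refine LinearMap.ext fun φ => eq_of_cmp_eq S fun i => ?_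
  rw [Module.End.mul_apply, Module.End.one_apply, cmp_covOpK S, LinearMap.smul_apply, map_smul, cmp_liftOp,
    Matrix.mulVec_smul, smul_smul, inv_mul_cancel₀ hℓ2, one_smul, Matrix.mulVec_mulVec,
    opS_mul_G S.toSetup ha hm hK1, Matrix.one_mulVec]

/-- **Left inverse**: `(ℓ²·lift G_K)·(−Δ^ε + μ₀² + a_K(L^Kε)^{−2}P_K) = 1`. [cite: Balaban1982Higgs1, (2.20) p.610; (2.22) p.610] -/
theorem lift_mul_covOpK (hK1 : 1 ≤ P.K) (ha : 0 < a) (hmu : 0 ≤ mu0sq) :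
    ((P.mesh P.K ^ 2) • liftOp S ((tower S.toSetup a (mu0sq * P.mesh P.K ^ 2)).G P.K))
        * covOpK (zeroCharge P.d) Finset.univ (0 : HiggsLattice.VecField P 0) mu0sq a P.K = 1 := by
  have hℓ2 : P.mesh P.K ^ 2 ≠ 0 := pow_ne_zero 2 (P.mesh_pos P.K).ne'
  have hm : 0 ≤ mu0sq * P.mesh P.K ^ 2 := mul_nonneg hmu (sq_nonneg _)
  refine LinearMap.ext fun φ => eq_of_cmp_eq S fun i => ?_
  rw [Module.End.mul_apply, Module.End.one_apply, LinearMap.smul_apply, map_smul, cmp_liftOp, cmp_covOpK S,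
    Matrix.mulVec_smul, smul_smul, mul_inv_cancel₀ hℓ2, one_smul, Matrix.mulVec_mulVec,
    G_mul_opS S.toSetup ha hm hK1, Matrix.one_mulVec]

/-- **The operator of (2.20) at zero field is invertible on the model's carrier** (`K ≧ 1`, `a > 0`, `μ₀² ≧ 0`; torus sub-family).
[cite: Balaban1982Higgs1, (2.20) p.610] -/
theorem isUnit_covOpK_zero (S : Shape P) (hK1 : 1 ≤ P.K) (ha : 0 < a) (hmu : 0 ≤ mu0sq) :
    IsUnit (covOpK (zeroCharge P.d) Finset.univ (0 : HiggsLattice.VecField P 0) mu0sq a P.K) :=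
  ⟨⟨_, _, covOpK_mul_lift S hK1 ha hmu, lift_mul_covOpK S hK1 ha hmu⟩, rfl⟩

/-- **(2.20) AT ZERO FIELD = `(L^Kε)²·`(2.22) OF THE TORUS TOWER**: the model's vector propagator `G^ε_K = propagatorK (zeroCharge d)
T_ε 0 μ₀² a K` (a `Ring.inverse`) IS `ℓ²·lift((B1RG242Torus.tower P_S a (μ₀²ℓ²)).G K)`, `ℓ = L^Kε`.
[cite: Balaban1982Higgs1, (2.20) p.610; (2.22) p.610] -/
theorem propagatorK_zero_eq (hK1 : 1 ≤ P.K) (ha : 0 < a) (hmu : 0 ≤ mu0sq) :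
    propagatorK (zeroCharge P.d) Finset.univ (0 : HiggsLattice.VecField P 0) mu0sq a P.K
      = (P.mesh P.K ^ 2) • liftOp S ((tower S.toSetup a (mu0sq * P.mesh P.K ^ 2)).G P.K) := by
  let u : (Module.End ℝ (HiggsLattice.ScalarField P 0 P.d))ˣ :=
    ⟨_, _, covOpK_mul_lift S hK1 ha hmu, lift_mul_covOpK S hK1 ha hmu⟩
  show Ring.inverse (u : Module.End ℝ (HiggsLattice.ScalarField P 0 P.d)) = _
  rw [Ring.inverse_unit]
  rfl

/-- **Pointwise**: `(G^ε_Kg)(x)_i = (L^Kε)²·(G_K cmp_i g)(e x)`. [cite: Balaban1982Higgs1, (2.20) p.610; (2.22) p.610] -/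
theorem propagatorK_zero_apply (hK1 : 1 ≤ P.K) (ha : 0 < a) (hmu : 0 ≤ mu0sq) (g : HiggsLattice.ScalarField P 0 P.d)
    (x : HiggsLattice.Site P 0) (i : Fin P.d) :
    (propagatorK (zeroCharge P.d) Finset.univ (0 : HiggsLattice.VecField P 0) mu0sq a P.K g x) i
      = P.mesh P.K ^ 2 * ((tower S.toSetup a (mu0sq * P.mesh P.K ^ 2)).G P.K *ᵥ cmp S i g) (eSite S (Nat.zero_le _) x) := by
  rw [propagatorK_zero_eq S hK1 ha hmu, LinearMap.smul_apply, Pi.smul_apply, PiLp.smul_apply, smul_eq_mul, liftOp_apply]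

end Propagator

/-! ## §3 B4 (1.10) on the torus, value clause at the top level, uniformly under a mass cap -/

section Torus

/-- **The `C^{(0)}` kernel bound (2.37) with a rate uniform under a mass cap**: for `0 ≦ m² ≦ m₊²`,
`|C^{(0)}(x,x′)| ≦ (2/γ₀)e^{−δ₁(m₊²)|x−x′|}` with `δ₁(m₊²) = dK0 d L a m₊²` (p38's `G0unit_decay` run with the cap in the (5.6)
constant). [cite: Balaban1983RegularityDecay, (2.37) p.582] -/
theorem G0unit_decay_cap {Q : Params} {a msq m2plus : ℝ} (ha : 0 < a) (hm : 0 ≤ msq) (hcap : msq ≤ m2plus)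
    (x x' : Site Q 0) :
    |G0unit Q a msq x x'| ≤ 2 / gamma0 Q.L a * Real.exp (-(dK0 Q.d Q.L a m2plus * T Q 0 x x')) := by
  have hL := Q.cast_L_pos
  have hL1 : (1 : ℝ) ≤ (Q.L : ℝ) := (one_lt_cast_L Q).le
  have hε := eps_le_one (P := Q)
  have hε0 := Q.eps_pos
  have hm2 : 0 ≤ m2plus := hm.trans hcap
  have hB : |Q.eps ^ 2 * msq| + 4 * Q.d + |a * ((Q.L : ℝ) ^ 2)⁻¹| ≤ m2plus + 4 * Q.d + a := by
    have h1 : |Q.eps ^ 2 * msq| ≤ m2plus := by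
      rw [abs_of_nonneg (by positivity)]
      calc Q.eps ^ 2 * msq ≤ 1 * msq := mul_le_mul_of_nonneg_right (pow_le_one₀ hε0.le hε) hm
        _ = msq := one_mul _
        _ ≤ m2plus := hcap
    have h2 : |a * ((Q.L : ℝ) ^ 2)⁻¹| ≤ a := by
      rw [abs_of_nonneg (by positivity)]
      calc a * ((Q.L : ℝ) ^ 2)⁻¹ ≤ a * 1 :=
            mul_le_mul_of_nonneg_left (inv_le_one_of_one_le₀ (one_le_pow₀ hL1)) ha.le
        _ = a := mul_one _
    linarith
  have hRe : (Q.L : ℝ) ^ lvl Q 1 - 1 ≤ (Q.L : ℝ) + 1 := by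
    have : (Q.L : ℝ) ^ lvl Q 1 ≤ (Q.L : ℝ) ^ 1 := pow_le_pow_right₀ hL1 (min_le_left _ _)
    rw [pow_one] at this
    linarith
  rw [G0unit_eq]
  exact blockOp_inv_decay (sitesPerDir_zero_eq Q 1) (by positivity) (gamma0_pos ha) (gamma0_le ha) (by positivity) hB
    (by linarith) hRe x x'

/-- **B4 THEOREM (1.10) ON THE TORUS, VALUE CLAUSE, TOP LEVEL, SOURCE NOT LOCALISED** (`dist(x, supp f) ≧ 0` only): for `d ≧ 1`, odd
`L > 1`, `a > 0` and a mass cap `m₊² ≧ 0` there is ONE `c₀ > 0` with `|(G^ε_Kf)(x)| ≦ c₀‖f‖_∞` for every volume `(m, K)` of Bałaban's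
scalar torus tower with `K ≧ 1` (top level = unit lattice, `G^ε_K = G_K(T, 0)` of B4 (1.6)) and every mass `0 ≦ m² ≦ m₊²` — p38's
`value_row_bound` ((2.34) + Lemma 2.4 + the `C^{(0)}` kernel) with the volume-uniform kernel inputs `kerBounds_torus` and the
mass-capped `G0unit_decay_cap`. [cite: Balaban1983RegularityDecay, Theorem (1.10) p.573; (2.34)–(2.39) p.582] -/
theorem torus_sup_bound (d L : ℕ) (hd : 1 ≤ d) (hL : Odd L ∧ 1 < L) {a : ℝ} (ha : 0 < a) {m2plus : ℝ} (hm2 : 0 ≤ m2plus) :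
    ∃ c₀ : ℝ, 0 < c₀ ∧ ∀ (Q : Params), Q.d = d → Q.L = L → 1 ≤ Q.K → ∀ (msq : ℝ), 0 ≤ msq → msq ≤ m2plus →
      ∀ (f : Site Q 0 → ℝ) (F : ℝ), (∀ z, |f z| ≤ F) → ∀ x : Site Q 0, |((tower Q a msq).G Q.K *ᵥ f) x| ≤ c₀ * F := by
  obtain ⟨C, δ, hC, hδ, hKB⟩ := kerBounds_torus d L hd hL ha m2plus
  obtain ⟨P₀, hP₀d, hP₀L⟩ : ∃ P₀ : Params, P₀.d = d ∧ P₀.L = L := ⟨⟨d, L, 0, 0, hd, hL⟩, rfl, rfl⟩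
  have hγ : 0 < gamma0 L a := by rw [← hP₀L]; exact gamma0_pos (P := P₀) ha
  have hδ₀ : 0 < dK0 d L a m2plus := by rw [← hP₀d, ← hP₀L]; exact dK0_pos (P := P₀) ha hm2
  have hL1 : (1 : ℝ) < L := by exact_mod_cast hL.2
  have h1 := B4Sect5Proof.latticeConst_nonneg d (show 0 ≤ dK0 d L a m2plus / 2 by positivity)
  have h2 := cTerm_nonneg d hC hδ
  have h3 : 0 ≤ 1 / ((L : ℝ) - 1) := div_nonneg zero_le_one (by linarith)
  have hC₀ : 0 ≤ 2 / gamma0 L a := (div_pos two_pos hγ).le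
  refine ⟨2 / gamma0 L a * B4Sect5Proof.latticeConst d (dK0 d L a m2plus / 2)
      + a ^ 2 * cTerm d C δ * (1 / ((L : ℝ) - 1)) + 1, by positivity, ?_⟩
  intro Q hQd hQL hK1 msq hmsq hcap f F hF x
  have hkm : Q.K ≤ Q.m + Q.K := Nat.le_add_left _ _
  have hcapK : Q.spacing Q.K ^ 2 * msq ≤ m2plus := by rw [Q.spacing_K, one_pow, one_mul]; exact hcap
  have hKB' : KerBounds Q a msq Q.K C δ := hKB Q hQd hQL msq hmsq Q.K hkm hcapK
  subst hQd hQL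
  have hG0 : ∀ y y' : Site Q 0, |G0unit Q a msq y y'| ≤ 2 / gamma0 Q.L a * Real.exp (-(dK0 Q.d Q.L a m2plus * T Q 0 y y')) :=
    fun y y' => G0unit_decay_cap ha hmsq hcap y y'
  have hF0 : 0 ≤ F := (abs_nonneg _).trans (hF x)
  have h := value_row_bound Q ha hmsq hK1 le_rfl hkm hC hδ hC₀ hδ₀ hKB' hG0 x f hF le_rfl (fun z _ => T_nonneg Q 0 x z)
  simp only [mul_zero, neg_zero, Real.exp_zero, mul_one] at h
  refine h.trans (mul_le_mul_of_nonneg_right ?_ hF0)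
  linarith

end Torus

/-! ## §4 (2.25), sup-norm clause, for the model's vector propagator at `A = 0`; §5 the vector half of (3.67) -/

section Model

/-- The components of an `ℝ^d`-valued field are bounded by its pointwise Euclidean norm. [cite: Balaban1982Higgs1, (1.5) p.604] -/
theorem abs_cmp_le (S : Shape P) {g : HiggsLattice.ScalarField P 0 P.d} {M : ℝ} (hg : ∀ x, ‖g x‖ ≤ M) (i : Fin P.d)
    (z : Site S.toSetup 0) : |cmp S i g z| ≤ M := by
  rw [cmp_apply, ← Real.norm_eq_abs]
  exact (PiLp.norm_apply_le _ i).trans (hg _)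

/-- A vector of `ℝ^d` with components bounded by `B ≧ 0` has Euclidean norm `≦ √d·B`. [cite: Balaban1982Higgs1, (1.5) p.604] -/
theorem norm_le_sqrt_mul {n : ℕ} (v : EuclideanSpace ℝ (Fin n)) {B : ℝ} (hB : 0 ≤ B) (h : ∀ i, |v i| ≤ B) :
    ‖v‖ ≤ Real.sqrt n * B := by
  rw [EuclideanSpace.norm_eq]
  calc Real.sqrt (∑ i, ‖v i‖ ^ 2) ≤ Real.sqrt (∑ _i : Fin n, B ^ 2) :=
        Real.sqrt_le_sqrt (Finset.sum_le_sum fun i _ =>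
          pow_le_pow_left₀ (norm_nonneg _) ((Real.norm_eq_abs _).le.trans (h i)) 2)
    _ = Real.sqrt n * B := by
        rw [Finset.sum_const, Finset.card_univ, Fintype.card_fin, nsmul_eq_mul, Real.sqrt_mul (Nat.cast_nonneg _),
          Real.sqrt_sq hB]

/-- **PROP. 2.1 (2.25), SUP-NORM CLAUSE, FOR THE (Higgs)₂,₃ MODEL'S VECTOR PROPAGATOR `G^ε_K` AT `A = 0` — PROVED, UNIFORMLY**: for
`d ≧ 1`, odd `L > 1`, `a > 0`, `μ₀² ≧ 0` and any `ε₀` there is ONE `c₀ > 0` (a function of `d, L, a, μ₀²ε₀²`: *"The constants in the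
above inequalities depend on d, a, M, α only"*) such that on EVERY torus `T_ε` of the sub-family `M·L′_μ = L^m`, for every `K ≧ 1`
with `L^Kε ≦ ε₀` and every `g : T_ε → ℝ^d` with `‖g(x)‖ ≦ M`:  `‖(G^ε_Kg)(x)‖ ≦ c₀(L^Kε)²M` — the displayed input `hGv` of
`B1Ineq367SmallField.chiW_eq_one_of_smallSet` / `B1Eq353SupNorm`, discharged.  Route: `propagatorK_zero_apply` + B4 (1.10) on the
torus (`torus_sup_bound`, mass `μ₀²(L^Kε)² ≦ μ₀²ε₀²`) + `‖v‖ ≦ √d·max_i|v_i|`. [cite: Balaban1982Higgs1, Prop. 2.1 (2.25) p.610] -/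
theorem propagatorK_sup_bound (d L : ℕ) (hd : 1 ≤ d) (hL : Odd L ∧ 1 < L) {a : ℝ} (ha : 0 < a) {mu0sq : ℝ}
    (hmu : 0 ≤ mu0sq) (ε₀ : ℝ) :
    ∃ c₀ : ℝ, 0 < c₀ ∧ ∀ (P : HiggsLattice.Params) (S : Shape P), P.d = d → P.L = L → 1 ≤ P.K → P.mesh P.K ≤ ε₀ →
      ∀ (g : HiggsLattice.ScalarField P 0 P.d) (M : ℝ), (∀ x, ‖g x‖ ≤ M) →
        ∀ x, ‖propagatorK (zeroCharge P.d) Finset.univ (0 : HiggsLattice.VecField P 0) mu0sq a P.K g x‖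
          ≤ c₀ * P.mesh P.K ^ 2 * M := by
  obtain ⟨c, hc, hG⟩ := torus_sup_bound d L hd hL ha (show 0 ≤ mu0sq * ε₀ ^ 2 by positivity)
  have hd0 : 0 < Real.sqrt d := Real.sqrt_pos.mpr (by exact_mod_cast hd)
  refine ⟨Real.sqrt d * c, mul_pos hd0 hc, ?_⟩
  intro P S hPd hPL hK1 hε g M hg x
  have hℓ := P.mesh_pos P.K
  have hM : 0 ≤ M := (norm_nonneg _).trans (hg x)
  have hcap : mu0sq * P.mesh P.K ^ 2 ≤ mu0sq * ε₀ ^ 2 :=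
    mul_le_mul_of_nonneg_left (pow_le_pow_left₀ hℓ.le hε 2) hmu
  have hcomp : ∀ i : Fin P.d,
      |(propagatorK (zeroCharge P.d) Finset.univ (0 : HiggsLattice.VecField P 0) mu0sq a P.K g x) i|
        ≤ P.mesh P.K ^ 2 * (c * M) := by
    intro i
    rw [propagatorK_zero_apply S hK1 ha hmu, abs_mul, abs_of_pos (pow_pos hℓ 2)]
    refine mul_le_mul_of_nonneg_left ?_ (pow_pos hℓ 2).le
    exact hG S.toSetup hPd hPL hK1 (mu0sq * P.mesh P.K ^ 2) (mul_nonneg hmu (sq_nonneg _)) hcap (cmp S i g) M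
      (abs_cmp_le S hg i) _
  calc ‖propagatorK (zeroCharge P.d) Finset.univ (0 : HiggsLattice.VecField P 0) mu0sq a P.K g x‖
      ≤ Real.sqrt P.d * (P.mesh P.K ^ 2 * (c * M)) := norm_le_sqrt_mul _ (by positivity) hcomp
    _ = Real.sqrt d * c * P.mesh P.K ^ 2 * M := by rw [hPd]; ring

/-- **THE VECTOR-FIELD HALF OF (3.67) WITH NO DISPLAYED INPUT**: on the torus sub-family, for `d ≧ 1`, odd `L > 1`, `a > 0`, `μ₀² > 0`,
any `ε₀`, with the `c₀` of `propagatorK_sup_bound`: for every `K ≧ 1` with `L^Kε ≦ ε₀` and every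
`c₁ ≧ a_K(c₀ + 1 + μ₀²c₀(L^Kε)² + a_Kc₀)`, `χ_K(A) = 1` ((3.27), thresholds `L^Kε`, `p`) whenever `|A(x)| ≦ c₁^{−1}(L^Kε)^{−(d−2)/2}p` at
every site — `B1Ineq367SmallField.chiKA_eq_one_of_small` with its input `hGv` supplied by `propagatorK_sup_bound`.
[cite: Balaban1982Higgs1, (3.67) p.625; (3.27) p.617; Prop. 2.1 (2.25) p.610] -/
theorem chiKA_eq_one_of_small_torus (d L : ℕ) (hd : 1 ≤ d) (hL : Odd L ∧ 1 < L) {a : ℝ} (ha : 0 < a) {mu0sq : ℝ}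
    (hmu : 0 < mu0sq) (ε₀ : ℝ) :
    ∃ c₀ : ℝ, 0 < c₀ ∧ ∀ (P : HiggsLattice.Params) (_S : Shape P), P.d = d → P.L = L → 1 ≤ P.K → P.mesh P.K ≤ ε₀ →
      ∀ (c₁ : ℝ), 0 < c₁ → B1.aSeq a P.L P.K * (c₀ + 1 + mu0sq * c₀ * P.mesh P.K ^ 2 + B1.aSeq a P.L P.K * c₀) ≤ c₁ →
        ∀ (p : ℝ) (A : HiggsLattice.VecField P P.K), (∀ x, ‖toSite A x‖ ≤ c₁⁻¹ * thrF P.d (P.mesh P.K) p) →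
          chiKA (P.mesh P.K) p mu0sq a P.K A = 1 := by
  obtain ⟨c₀, hc₀, hGv⟩ := propagatorK_sup_bound d L hd hL ha hmu.le ε₀
  refine ⟨c₀, hc₀, fun P S hPd hPL hK1 hε c₁ hc₁0 hc₁ p A hA => ?_⟩
  have hL1 : (1 : ℝ) < P.L := by rw [hPL]; exact_mod_cast hL.2
  exact chiKA_eq_one_of_small le_rfl hmu (B1.aSeq_pos ha hL1 hK1).le hc₀.le hc₁0 hc₁
    (fun g M hg y => hGv P S hPd hPL hK1 hε g M hg y) hA

end Model

end Literature.MathematicalPhysics.QuantumFieldTheory.Balaban1983to89.B1Ineq225ZeroFieldTorus
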